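import Summits.ResolutionOfSingularities.ResolutionOfSingularities.Theorems.FrobeniusLadderFInjectiveMacaulayficationF108ConsumableRelHolds
import Summits.ResolutionOfSingularities.ResolutionOfSingularities.Theorems.FrobeniusLadderFInjectiveMacaulayficationAutMonomialFloorCured
import HarnessLib

/-!
# THE MONOMIAL-FLOOR COLUMN, UNCONDITIONAL: `monomialFloorCured`, `brieskornPham_monomialFloorCured`, `autMonomialFloorCured` WITHOUT the binder `hF`
# (crux `FInjectiveMacaulayfication` stmt-ResolutionOfSingularities-15315, chain w45a; res-L1-w45a-plan-1 RULING R22.34 (2) «stub-1 g14 FILES the hF-free corollaries»; seat res-L1-w45a-stub-1 g14)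

[OURS · L1 W4.5a] Support file (`--supports stmt-ResolutionOfSingularities-15315 --as helper`); theorems only; UNCONDITIONAL — the interface `MonomialFloorClassRow.F108ConsumableRel k n`
(✓p685336, an OURS open-obligation node) is DISCHARGED in the kernel by res-L1-toric-fan g2 ✓p690554 `MonomialFloorClassRow.F108ConsumableRel_holds` (+ ✓p690109 `…F108ToricRel`), so the
three conditional theorems of ✓p685336 / ✓p686042 lose their binder `hF` (one term each). No Literature fact beyond those already behind the cited theorems. Nothing of the crux is
proved; no census row of a specific bed is asserted here beyond the families named. AI-written (AI review is weaker than expert review).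

* ★★ `monomialFloorCured` — `k = k̄` of characteristic `p`, `n ≥ 1`, `f` prime, convenient, weakly non-degenerate along every positive weight, `x̄ᵢ ≠ 0`, `X = V(f)` regular off the
  vertex `v`: for EVERY finite exponent set `B` with a positive pure power of every variable, EVERY blowing up of `Spec 𝒪_{X,v}` along `(x^B)~` is CURED (a nonzero ideal sheaf
  cosupported over the closed point all of whose blowings up are `F`-injective = FULL everywhere).
* ★ `brieskornPham_monomialFloorCured` — the Brieskorn–Pham beds `z^c + x^{a₀} + y^{a₁} + u^{a₂} + w^{a₃}`, `2 ≤ c < a_j`, `a_j ≠ 0` in `k`.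
* ★★ `autMonomialFloorCured` — transport along a `k`-algebra automorphism `φ` of `k[X]` fixing the origin: every blowing up of `Spec 𝒪_{V(f),0}` along `(φ⁻¹(x^B))~` is cured when
  `g = φ f` satisfies the class hypotheses.
WHAT THIS DOES NOT SAY: admissibility / normality of these floors (not needed for the cure), NOT-FULLness of a floor (per floor, Fedder data), anything about non-monomial centres
(BED Ω, pencils — GAP-1's remaining content), anything about beds failing weak non-degeneracy (BED D, TCb, TCc — GAP-2).
NOTE (BED T, two routes of record): for the `(4,3)` T-bed the census now holds the explicit T″-instance rows (✓p685842 `X2CyclicCubicChar3.cyclic_tStep_row_char3` / `cyclic_tInstance_char3`)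
AND, wherever its germ meets the class hypotheses, the monomial-floor cure of this file; the two routes are independent kernel proofs and neither is used by the other.
[cite: IshiiSingularities2018, Thm. 4.4.23] [cite: CoxLittleSchenck2011, Thm. 11.1.9]
-/

set_option linter.dupNamespace false

noncomputable section

namespace Summit.ResolutionOfSingularities.ResolutionOfSingularities.Theorems.FInjectiveMacaulayfication.MonomialFloorUnconditional

open CategoryTheory CategoryTheory.Limits AlgebraicGeometry TopologicalSpace IsLocalRing MvPolynomial
open Literature.AlgebraicGeometry.Resolution Literature.AlgebraicGeometry.Resolution.BoubakriGreuelMarkwig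
open Summit.ResolutionOfSingularities.ResolutionOfSingularities.Theorems.FInjectiveMacaulayfication
open SliceableCentre

variable (k : Type) [Field k] {n : ℕ}

/-- ★★ **EVERY `𝔪`-PRIMARY MONOMIAL FLOOR OF A CONVENIENT WEAKLY-NON-DEGENERATE ISOLATED HYPERSURFACE GERM IS CURED — UNCONDITIONALLY** (✓p685336 §3 with
`hF := F108ConsumableRel_holds k n`, ✓p690554). [OURS · kernel theorem; cite: IshiiSingularities2018, Thm. 4.4.23] -/
theorem monomialFloorCured (p : ℕ) [Fact p.Prime] [IsAlgClosed k] [CharP k p] (hn : 0 < n)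
    (f : MvPolynomial (Fin n) k) (hfp : Prime f) (hconv : ∀ j : Fin n, ∃ N : ℕ, 0 < N ∧ MvPolynomial.coeff (Finsupp.single j N) f ≠ 0)
    (hWND : ∀ w : Fin n → ℝ, (∀ i, 0 < w i) → IsWeaklyNondegenerateAlong w (f : MvPowerSeries (Fin n) k))
    (hXne : ∀ v : Fin n, Ideal.Quotient.mk (Ideal.span {f}) (X v) ≠ 0)
    (hreg : ∀ x : Spec (.of (MvPolynomial (Fin n) k ⧸ Ideal.span {f})),
      ¬ Ideal.span (Set.range fun j : Fin n => Ideal.Quotient.mk (Ideal.span {f}) (X j)) ≤ x.asIdeal → IsRegularLocalRing (Localization.AtPrime x.asIdeal))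
    (B : Finset (Fin n →₀ ℕ)) (hB : ∀ j : Fin n, ∃ N : ℕ, 0 < N ∧ Finsupp.single j N ∈ B)
    (v : Spec (.of (MvPolynomial (Fin n) k ⧸ Ideal.span {f})))
    (hvm : v.asIdeal = Ideal.span (Set.range fun j : Fin n => Ideal.Quotient.mk (Ideal.span {f}) (X j))) :
    ∀ (S' : Scheme.{0}) (gS : S' ⟶ Spec ((Spec (.of (MvPolynomial (Fin n) k ⧸ Ideal.span {f}))).presheaf.stalk v)),
      IsBlowup gS ((affineBlowup.idealSheaf (Ideal.span ((fun e : Fin n →₀ ℕ => Ideal.Quotient.mk (Ideal.span {f}) (monomial e (1 : k))) '' (B : Set (Fin n →₀ ℕ))))).comap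
        ((Spec (.of (MvPolynomial (Fin n) k ⧸ Ideal.span {f}))).fromSpecStalk v)) →
      ∃ 𝓚 : S'.IdealSheafData, 𝓚 ≠ ⊥ ∧
        (∀ s ∈ (𝓚.support : Set S'), gS.base s = closedPoint ((Spec (.of (MvPolynomial (Fin n) k ⧸ Ideal.span {f}))).presheaf.stalk v)) ∧
        ∀ (S'' : Scheme.{0}) (π : S'' ⟶ S'), IsBlowup π 𝓚 → ∀ s : S'', FullCl p (S''.presheaf.stalk s) :=
  MonomialFloorClassRow.monomialFloorCured_of_F108ConsumableRel k p (MonomialFloorClassRow.F108ConsumableRel_holds k n) hn f hfp hconv hWND hXne hreg B hB v hvm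

/-- ★ **EVERY `𝔪`-PRIMARY MONOMIAL FLOOR OF EVERY BRIESKORN–PHAM BED IS CURED — UNCONDITIONALLY** (✓p685336 §4 with `hF := F108ConsumableRel_holds k 5`). [OURS · kernel theorem;
cite: IshiiSingularities2018, Thm. 4.4.23] -/
theorem brieskornPham_monomialFloorCured (p : ℕ) [Fact p.Prime] [IsAlgClosed k] [CharP k p]
    (c a₀ a₁ a₂ a₃ : ℕ) (hc : 2 ≤ c) (h₀ : c < a₀) (h₁ : c < a₁) (h₂ : c < a₂) (h₃ : c < a₃)
    (ha₀ : ((a₀ : ℕ) : k) ≠ 0) (ha₁ : ((a₁ : ℕ) : k) ≠ 0) (ha₂ : ((a₂ : ℕ) : k) ≠ 0) (ha₃ : ((a₃ : ℕ) : k) ≠ 0)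
    (f : MvPolynomial (Fin 5) k) (hf : f = X 4 ^ c + X 0 ^ a₀ + X 1 ^ a₁ + X 2 ^ a₂ + X 3 ^ a₃)
    (B : Finset (Fin 5 →₀ ℕ)) (hB : ∀ j : Fin 5, ∃ N : ℕ, 0 < N ∧ Finsupp.single j N ∈ B)
    (v : Spec (.of (MvPolynomial (Fin 5) k ⧸ Ideal.span {f})))
    (hv : v.asIdeal = Ideal.span (Set.range fun j : Fin 5 => Ideal.Quotient.mk (Ideal.span {f}) (X j))) :
    ∀ (S' : Scheme.{0}) (gS : S' ⟶ Spec ((Spec (.of (MvPolynomial (Fin 5) k ⧸ Ideal.span {f}))).presheaf.stalk v)),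
      IsBlowup gS ((affineBlowup.idealSheaf (Ideal.span ((fun e : Fin 5 →₀ ℕ => Ideal.Quotient.mk (Ideal.span {f}) (monomial e (1 : k))) '' (B : Set (Fin 5 →₀ ℕ))))).comap
        ((Spec (.of (MvPolynomial (Fin 5) k ⧸ Ideal.span {f}))).fromSpecStalk v)) →
      ∃ 𝓚 : S'.IdealSheafData, 𝓚 ≠ ⊥ ∧
        (∀ s ∈ (𝓚.support : Set S'), gS.base s = closedPoint ((Spec (.of (MvPolynomial (Fin 5) k ⧸ Ideal.span {f}))).presheaf.stalk v)) ∧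
        ∀ (S'' : Scheme.{0}) (π : S'' ⟶ S'), IsBlowup π 𝓚 → ∀ s : S'', FullCl p (S''.presheaf.stalk s) :=
  MonomialFloorClassRow.brieskornPham_monomialFloorCured_of_F108ConsumableRel k p (MonomialFloorClassRow.F108ConsumableRel_holds k 5)
    c a₀ a₁ a₂ a₃ hc h₀ h₁ h₂ h₃ ha₀ ha₁ ha₂ ha₃ f hf B hB v hv

/-- ★★ **TRANSPORTED MONOMIAL FLOORS ARE CURED — UNCONDITIONALLY** (✓p686042 with `hF := F108ConsumableRel_holds k n`): `φ` a ring automorphism of `k[X]` fixing the origin both ways,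
`g = φ f` prime, convenient, weakly non-degenerate, `x̄ᵢ ≠ 0`, `V(g)` regular off the origin, `I` with `φ(I) = (x^B)`: every blowing up of `Spec 𝒪_{V(f),0}` along `Ĩ` is cured.
[OURS · kernel theorem; cite: IshiiSingularities2018, Thm. 4.4.23] -/
theorem autMonomialFloorCured (p : ℕ) [Fact p.Prime] [IsAlgClosed k] [CharP k p] (hn : 0 < n)
    (φ : MvPolynomial (Fin n) k ≃+* MvPolynomial (Fin n) k)
    (h₁ : ∀ i : Fin n, constantCoeff (φ (X i)) = 0) (h₂ : ∀ i : Fin n, constantCoeff (φ.symm (X i)) = 0)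
    (f g : MvPolynomial (Fin n) k) (hfg : φ f = g) (hgp : Prime g)
    (hconv : ∀ j : Fin n, ∃ N : ℕ, 0 < N ∧ MvPolynomial.coeff (Finsupp.single j N) g ≠ 0)
    (hWND : ∀ w : Fin n → ℝ, (∀ i, 0 < w i) → IsWeaklyNondegenerateAlong w (g : MvPowerSeries (Fin n) k))
    (hXne : ∀ v : Fin n, Ideal.Quotient.mk (Ideal.span {g}) (X v) ≠ 0)
    (hreg : ∀ x : Spec (.of (MvPolynomial (Fin n) k ⧸ Ideal.span {g})),
      ¬ Ideal.span (Set.range fun j : Fin n => Ideal.Quotient.mk (Ideal.span {g}) (X j)) ≤ x.asIdeal → IsRegularLocalRing (Localization.AtPrime x.asIdeal))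
    (I : Ideal (MvPolynomial (Fin n) k)) (B : Finset (Fin n →₀ ℕ)) (hB : ∀ j : Fin n, ∃ N : ℕ, 0 < N ∧ Finsupp.single j N ∈ B)
    (hI : I.map φ.toRingHom = Ideal.span ((fun e : Fin n →₀ ℕ => (monomial e (1 : k) : MvPolynomial (Fin n) k)) '' (B : Set (Fin n →₀ ℕ))))
    (v' : Spec (.of (MvPolynomial (Fin n) k ⧸ Ideal.span {f})))
    (hv' : v'.asIdeal = Ideal.span (Set.range fun j : Fin n => Ideal.Quotient.mk (Ideal.span {f}) (X j))) :
    ∀ (S' : Scheme.{0}) (gS : S' ⟶ Spec ((Spec (.of (MvPolynomial (Fin n) k ⧸ Ideal.span {f}))).presheaf.stalk v')),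
      IsBlowup gS ((affineBlowup.idealSheaf (I.map (Ideal.Quotient.mk (Ideal.span {f})))).comap
        ((Spec (.of (MvPolynomial (Fin n) k ⧸ Ideal.span {f}))).fromSpecStalk v')) →
      ∃ 𝓚 : S'.IdealSheafData, 𝓚 ≠ ⊥ ∧
        (∀ s ∈ (𝓚.support : Set S'), gS.base s = closedPoint ((Spec (.of (MvPolynomial (Fin n) k ⧸ Ideal.span {f}))).presheaf.stalk v')) ∧
        ∀ (S'' : Scheme.{0}) (π : S'' ⟶ S'), IsBlowup π 𝓚 → ∀ s : S'', FullCl p (S''.presheaf.stalk s) :=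
  AutMonomialFloorCured.autMonomialFloorCured_of_F108ConsumableRel k p (MonomialFloorClassRow.F108ConsumableRel_holds k n) hn φ h₁ h₂ f g hfg hgp hconv hWND hXne hreg
    I B hB hI v' hv'

end Summit.ResolutionOfSingularities.ResolutionOfSingularities.Theorems.FInjectiveMacaulayfication.MonomialFloorUnconditional

end
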